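import Summits.QuantumFields.BalabanUV.Beta.FP.ReGaugedShotDeterminant
import Mathlib.Algebra.QuadraticDiscriminant

/-!
# `BalabanUV.Beta.FP.ResidualModeIdentities` — road «FP» for binder row D1, row H′2-IR ∕ IR-3, sub-row **IR-3-ID**: the SQUARE-ROOT-FREE
# model identities (I1)–(I5) of the owner's `IR3-DESIGN.md` (d1-p3-g5, 2026-08-20) for the residual-mode operator of Bałaban's covariant
# inner slice, over the landed `FP/ConstrainedWoodbury` ∕ `FP/ReGaugedShotDeterminant`

HONEST DEPENDENCY (page 1, mandatory): continuum YM on T⁴ ⇐ BetaPertH ∧ nine spine estimates (0/9 proved); BetaPertH ⇐ (D1) ∧ (D4) ∧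
CAP+tail; G-an2-4 gates asym, D1 and NE2/3/4.  HONEST FRAMING (cell contract, verbatim): «discharging `BetaPertH` makes Bałaban's UV
stability UNCONDITIONAL — a real constructive-QFT result; it is NOT the continuum limit and NOT the Clay problem.»  THIS MODULE is [folklore]
finite-dimensional linear algebra over a field (`ℝ` for the positivity statements) on the cell's own bordered-inverse dictionary
(`Beta.Composition.kkt ∕ blockProp`, `Beta.CompositionSingular.flucCov ∕ minOp ∕ minOpL`, `Beta.Envelope.constrProp ∕ minMap`) and the landed
road-FP model files `FP/ConstrainedWoodbury` (leaf-05-g8, p234066: `lift_mul_kktInv_mul_lift_transpose`, `lift_mul_kktInv`, `flucCov_transpose_of_symm`)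
∕ `FP/ReGaugedShotDeterminant` (owner, p235350) BY NAME; MODEL level; no `def`, no `def … : Prop`, nothing cited, 0 `sorry`; 0 estimates; 0∕4
binders of row D1; NOT IR-3-ELL ∕ LOC ∕ RG (the letters), NOT hbook, NOT hasym, NOT D1, NOT BetaPertH, NOT continuum, NOT Clay.

ABSOLUTE RULE (cell charter, verbatim): «No internally-minted statement may enter as a cited fact. Every hypothesis is either kernel-proved in this
package or a verbatim quotation of a PUBLISHED theorem with page reference. The manuscript(s) under audit are NOT citable for their own disputed
steps — they are the thing under adjudication; programme-internal (2001/route/tribunal) claims are never citable.»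

THE READING (IR3-DESIGN §0–§1; orientation only, nothing of it is asserted here).  Fine form `H` (= `H_∞ + dd*`; invertible, symmetric),
`P := H⁻¹`; block averaging `Q`; `Γ₀ := flucCov H Q` (= `constrProp H Q = P − PQᵀG_C QP`), `G_C := (blockProp H Q)⁻¹ = (QPQᵀ)⁻¹`.  The memo's
deficit is `EᵀE`, `E := Mid^{−1/2}·F`, `F := Q′Δ⁻¹d*` the RAW deficit rows, `Mid := Q′Δ⁻²Q′ᵀ = F P Fᵀ`; (I1) is `E P Eᵀ = 1`.  HERE the deficit
is written `Fᵀ·Mid⁻¹·F` (= `EᵀE` for ANY `N` with `NᵀN = Mid⁻¹`, §1), so that NO SQUARE ROOT occurs anywhere: raw letters `S₀ := Q P Fᵀ` (= `d^c·Mid`;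
the memo's `S = S₀Mid^{−1/2}`), `V := QPQᵀ − S₀Mid⁻¹S₀ᵀ` (= `QP^TQᵀ`), `J := Γ₀Fᵀ`, `K_C⁻¹ := Mid − FΓ₀Fᵀ` (= `Mid^{1/2}M_B Mid^{1/2} = Mid·L_C·Mid`).

CONTENT (any field `𝕜`; `ℝ` where positivity is stated).
* §1 (I1) WHITENING BOOKKEEPING: `F P Fᵀ = Mid ∧ N Mid Nᵀ = 1 ⟹ (NF)P(NF)ᵀ = 1`; `NᵀN = Mid⁻¹ ⟹ (NF)ᵀ(NF) = FᵀMid⁻¹F`; `N Mid Nᵀ = 1`, `N` invertible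
  `⟹ NᵀN = Mid⁻¹` — the whitened and the raw deficit define the same downdated form `H − EᵀE = H − FᵀMid⁻¹F`.
* §2 (I2) **`Mid − F·Γ₀·Fᵀ = S₀ᵀ·G_C·S₀`** (`H` invertible symmetric, `blockProp H Q` invertible, `F H⁻¹ Fᵀ = Mid`); at `Mid = 1`: `M_B = SᵀG_C S`.
* §3 (I3) the square-root-free HODGE CONGRUENCE **`P − PFᵀMid⁻¹FP = (1 − PFᵀMid⁻¹F)·P·(1 − PFᵀMid⁻¹F)ᵀ`**, the split **`QPQᵀ = S₀Mid⁻¹S₀ᵀ + V`**,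
  over `ℝ`: `V ⪰ 0` for `P ⪰ 0`; the same congruence at `F := Q`, `Mid := blockProp H Q` gives **`flucCov H Q ⪰ 0`** for `H ≻ 0` (`posSemidef_flucCov`).
* §4 (I4) PUSH-THROUGH **`Sᵀ(V + SWSᵀ)⁻¹S = W⁻¹ − W⁻¹(W⁻¹ + SᵀV⁻¹S)⁻¹W⁻¹`** (Mathlib's Woodbury `Matrix.add_mul_mul_inv_eq_sub` BY NAME), its `W = 1`
  form `= 1 − (1 + SᵀV⁻¹S)⁻¹`, and over `ℝ` the LOEWNER SANDWICH in raw letters WITHOUT inverting `V` (the memo's «generalised-inverse reading»):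
  **`0 ⪯ S₀ᵀG_C S₀ ⪯ Mid`** (`H ≻ 0`), i.e. `0 ⪯ M_B ⪯ 1`.
* §5 division-free CAUCHY–SCHWARZ **`(w ⬝ Au)² ≤ (w ⬝ Aw)(u ⬝ Au)`** (`A ⪰ 0`), **`(u ⬝ u)² ≤ (u ⬝ A⁻¹u)(u ⬝ Au)`** (`A ≻ 0`) and the per-direction
  bound **`|Sφ|⁴ ≤ ⟨φ, SᵀA⁻¹Sφ⟩·⟨Sφ, A Sφ⟩`** (IR3-DESIGN (I4) at `A := QPQᵀ = S₀Mid⁻¹S₀ᵀ + V`, general-rank form).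
* §6 (I5) the WEIGHTED constrained Woodbury **`flucCov (H − FᵀWF) Q = Γ₀ + Γ₀Fᵀ(W⁻¹ − FΓ₀Fᵀ)⁻¹FΓ₀`** under `IsUnit (kkt H Q).det`, `IsUnit W.det`,
  `IsUnit (W⁻¹ − FΓ₀Fᵀ).det` ONLY (twin of g8's `flucCov_downdate`), its `W := Mid⁻¹` form, **`R^g := Γ^{cov} − Γ₀ = J·K_C·Jᵀ`** (`H` symmetric) and
  **`det Mid · det kkt (H − FᵀMid⁻¹F) Q = det kkt H Q · det (Mid − FΓ₀Fᵀ)`** `= det kkt H Q · det (S₀ᵀG_C S₀)` — the residual-mode factor of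
  `ReGaugedShotDeterminant.det_kkt_downdate` without `Mid^{±1/2}`.
Provenance: NE9 formalisation swarm (idle-seat cross-lane duty NE9 → road FP), unit b2b-balaban-t4-ne9-formalise-leaf-08 gen 28
(prover-b2b-balaban-t4-ne9-formalise-leaf-08-g28-0), 2026-08-20; sub-row IR-3-ID of the owner's IR3-DESIGN §4 («any seat»).  [folklore], 0 def, 0 cite, 0 sorry.
-/

namespace Summit.QuantumFields.BalabanUV.Beta.FP.ResidualModeIdentities

open scoped Matrix
open Matrix
open Literature.MathematicalPhysics.QuantumFieldTheory.Balaban1983to89.Beta.Composition (kkt blockProp)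
open Literature.MathematicalPhysics.QuantumFieldTheory.Balaban1983to89.Beta.Envelope (constrProp minMap)
open Literature.MathematicalPhysics.QuantumFieldTheory.Balaban1983to89.Beta.CompositionSingular (flucCov minOp minOpL kkt_eq_fromBlocks flucCov_eq_constrProp)
open Summit.QuantumFields.BalabanUV.Beta.FP.ConstrainedWoodbury (lift_mul_kktInv_mul_lift_transpose lift_mul_kktInv flucCov_transpose_of_symm)

variable {𝕜 : Type*} [Field 𝕜]
variable {ι κ ν μ : Type*} [Fintype ι] [Fintype κ] [Fintype ν] [Fintype μ] [DecidableEq ι] [DecidableEq κ] [DecidableEq ν] [DecidableEq μ]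

/-! ## §1 (I1) Whitening bookkeeping: the raw and the whitened deficit are the same form -/

omit [DecidableEq ν] in
/-- [folklore] (I1), raw ⟹ whitened: if the raw deficit rows satisfy `F P Fᵀ = Mid` and `N` whitens `Mid` (`N Mid Nᵀ = 1`), then
`E := N F` has `E P Eᵀ = 1` — the memo's (I1) `E P Eᵀ = 1` for `E = Mid^{−1/2}Q′Δ⁻¹d*`; any whitening `N` will do, none is used below. -/
theorem whiten_mul_mul_transpose (P : Matrix ν ν 𝕜) (F : Matrix κ ν 𝕜) (Mid N : Matrix κ κ 𝕜) (hF : F * P * Fᵀ = Mid)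
    (hN : N * Mid * Nᵀ = 1) : (N * F) * P * (N * F)ᵀ = 1 := by
  have h1 : (N * F) * P * (N * F)ᵀ = N * (F * P * Fᵀ) * Nᵀ := by simp only [Matrix.mul_assoc, transpose_mul]
  rw [h1, hF, hN]

omit [Fintype ν] [DecidableEq ν] in
/-- [folklore] (I1), the downdated form: `NᵀN = Mid⁻¹ ⟹ (NF)ᵀ(NF) = Fᵀ·Mid⁻¹·F` — the deficit `EᵀE` depends on the whitening only through
`NᵀN`, so `H − EᵀE = H − FᵀMid⁻¹F` is square-root-free. -/
theorem whiten_transpose_mul_self (F : Matrix κ ν 𝕜) (Mid N : Matrix κ κ 𝕜) (hN : Nᵀ * N = Mid⁻¹) :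
    (N * F)ᵀ * (N * F) = Fᵀ * Mid⁻¹ * F := by
  have h1 : (N * F)ᵀ * (N * F) = Fᵀ * (Nᵀ * N) * F := by simp only [Matrix.mul_assoc, transpose_mul]
  rw [h1, hN]

/-- [folklore] (I1), consistency of the two whitening conditions: an INVERTIBLE `N` with `N Mid Nᵀ = 1` has `NᵀN = Mid⁻¹`. -/
theorem transpose_mul_self_eq_inv_of_whiten (Mid N : Matrix κ κ 𝕜) (hN : N * Mid * Nᵀ = 1) (hNu : IsUnit N.det) :
    Nᵀ * N = Mid⁻¹ := by
  have h1 : N⁻¹ = Mid * Nᵀ := Matrix.inv_eq_right_inv (by rw [← Matrix.mul_assoc]; exact hN)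
  have h2 : Mid * (Nᵀ * N) = 1 := by rw [← Matrix.mul_assoc, ← h1, Matrix.nonsing_inv_mul N hNu]
  exact (Matrix.inv_eq_right_inv h2).symm

/-! ## §2 (I2) The residual-mode matrix is a coarse sandwich of `G_C` -/

omit [Fintype κ] [DecidableEq κ] in
/-- [folklore] **(I2), RAW LETTERS**: for invertible symmetric `H` with `blockProp H Q = QH⁻¹Qᵀ` invertible and raw deficit rows with
`F H⁻¹ Fᵀ = Mid`,  `Mid − F·flucCov H Q·Fᵀ = (QH⁻¹Fᵀ)ᵀ·(blockProp H Q)⁻¹·(QH⁻¹Fᵀ)` — i.e. `K_C⁻¹ = Mid·L_C·Mid = S₀ᵀ G_C S₀`, `S₀ := Q P Fᵀ`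
(equivalently `F·R^Q·Fᵀ = S₀ᵀG_C S₀`, `R^Q = P − Γ₀ = PQᵀG_C QP`). -/
theorem weight_sub_deficitCov_eq (H : Matrix ν ν 𝕜) (Q : Matrix μ ν 𝕜) (F : Matrix κ ν 𝕜) (Mid : Matrix κ κ 𝕜) (hH : IsUnit H.det)
    (hP : IsUnit (blockProp H Q).det) (hHs : Hᵀ = H) (hF : F * H⁻¹ * Fᵀ = Mid) :
    Mid - F * flucCov H Q * Fᵀ = (Q * H⁻¹ * Fᵀ)ᵀ * (blockProp H Q)⁻¹ * (Q * H⁻¹ * Fᵀ) := by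
  have hPs : (H⁻¹)ᵀ = H⁻¹ := by rw [transpose_nonsing_inv, hHs]
  subst hF
  rw [flucCov_eq_constrProp H Q hH hP]
  simp only [constrProp, minMap]
  rw [Matrix.mul_sub, Matrix.sub_mul, sub_sub_cancel]
  simp only [transpose_mul, transpose_transpose, hPs, Matrix.mul_assoc]

omit [Fintype κ] in
/-- [folklore] **(I2), WHITENED** (the memo's letters, `Mid = 1`): `E H⁻¹ Eᵀ = 1 ⟹ M_B := 1 − E·flucCov H Q·Eᵀ = Sᵀ·G_C·S` with
`S := Q H⁻¹ Eᵀ`, `G_C := (blockProp H Q)⁻¹`. -/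
theorem one_sub_deficitCov_eq (H : Matrix ν ν 𝕜) (Q : Matrix μ ν 𝕜) (E : Matrix κ ν 𝕜) (hH : IsUnit H.det)
    (hP : IsUnit (blockProp H Q).det) (hHs : Hᵀ = H) (hE : E * H⁻¹ * Eᵀ = 1) :
    1 - E * flucCov H Q * Eᵀ = (Q * H⁻¹ * Eᵀ)ᵀ * (blockProp H Q)⁻¹ * (Q * H⁻¹ * Eᵀ) :=
  weight_sub_deficitCov_eq H Q E 1 hH hP hHs hE

/-! ## §3 (I3) The square-root-free Hodge congruence and the split `QPQᵀ = S₀Mid⁻¹S₀ᵀ + V` -/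

/-- [folklore] **(I3), THE CONGRUENCE**: for symmetric `P` and rows `F` with `F P Fᵀ = Mid` invertible,
`P − P·Fᵀ·Mid⁻¹·F·P = (1 − PFᵀMid⁻¹F)·P·(1 − PFᵀMid⁻¹F)ᵀ` — the reading's "transverse part" is a congruence of `P` (no `P^{1/2}`). -/
theorem sub_sandwich_eq_congruence (P : Matrix ν ν 𝕜) (F : Matrix κ ν 𝕜) (Mid : Matrix κ κ 𝕜) (hPs : Pᵀ = P)
    (hF : F * P * Fᵀ = Mid) (hMid : IsUnit Mid.det) :
    P - P * Fᵀ * Mid⁻¹ * F * P = (1 - P * Fᵀ * Mid⁻¹ * F) * P * (1 - P * Fᵀ * Mid⁻¹ * F)ᵀ := by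
  have hMs : Midᵀ = Mid := by
    rw [← hF]; simp only [transpose_mul, transpose_transpose, hPs, Matrix.mul_assoc]
  have hMis : (Mid⁻¹)ᵀ = Mid⁻¹ := by rw [transpose_nonsing_inv, hMs]
  have hAt : (P * Fᵀ * Mid⁻¹ * F)ᵀ = Fᵀ * Mid⁻¹ * F * P := by
    simp only [transpose_mul, transpose_transpose, hMis, hPs, Matrix.mul_assoc]
  have key : P * Fᵀ * Mid⁻¹ * F * P * (Fᵀ * Mid⁻¹ * F * P) = P * Fᵀ * Mid⁻¹ * F * P := by
    calc P * Fᵀ * Mid⁻¹ * F * P * (Fᵀ * Mid⁻¹ * F * P)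
        = P * Fᵀ * Mid⁻¹ * (F * P * Fᵀ) * (Mid⁻¹ * (F * P)) := by simp only [Matrix.mul_assoc]
      _ = P * Fᵀ * Mid⁻¹ * F * P := by
          rw [hF, Matrix.mul_assoc (P * Fᵀ) Mid⁻¹ Mid, Matrix.nonsing_inv_mul Mid hMid, Matrix.mul_one]
          simp only [Matrix.mul_assoc]
  have hPB : P * (Fᵀ * Mid⁻¹ * F * P) = P * Fᵀ * Mid⁻¹ * F * P := by simp only [Matrix.mul_assoc]
  rw [transpose_sub, transpose_one, hAt]
  simp only [Matrix.sub_mul, Matrix.mul_sub, Matrix.one_mul, Matrix.mul_one]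
  rw [key, hPB]
  abel

omit [Fintype μ] [DecidableEq ν] [DecidableEq μ] in
/-- [folklore] **(I3), THE SPLIT** (pure algebra, `P` symmetric): `QPQᵀ = (QPFᵀ)·Mid⁻¹·(QPFᵀ)ᵀ + Q·(P − PFᵀMid⁻¹FP)·Qᵀ`, i.e.
`G_C⁻¹ = S₀Mid⁻¹S₀ᵀ + V` with `S₀ := QPFᵀ`, `V := Q·(P − PFᵀMid⁻¹FP)·Qᵀ`. -/
theorem blockProp_split (P : Matrix ν ν 𝕜) (Q : Matrix μ ν 𝕜) (F : Matrix κ ν 𝕜) (Mid : Matrix κ κ 𝕜) (hPs : Pᵀ = P) :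
    Q * P * Qᵀ = (Q * P * Fᵀ) * Mid⁻¹ * (Q * P * Fᵀ)ᵀ + Q * (P - P * Fᵀ * Mid⁻¹ * F * P) * Qᵀ := by
  have h1 : (Q * P * Fᵀ)ᵀ = F * P * Qᵀ := by simp only [transpose_mul, transpose_transpose, hPs, Matrix.mul_assoc]
  rw [h1]
  simp only [Matrix.mul_sub, Matrix.sub_mul, Matrix.mul_assoc]
  abel

omit [DecidableEq μ] in
/-- [folklore] **(I3), POSITIVITY of `V`** over `ℝ`: for positive semidefinite `P` and `F P Fᵀ = Mid` invertible,
`V := Q·(P − PFᵀMid⁻¹FP)·Qᵀ` is positive semidefinite (a congruence of `P` by §3's identity). -/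
theorem posSemidef_transverseBlock (P : Matrix ν ν ℝ) (Q : Matrix μ ν ℝ) (F : Matrix κ ν ℝ) (Mid : Matrix κ κ ℝ)
    (hP : P.PosSemidef) (hF : F * P * Fᵀ = Mid) (hMid : IsUnit Mid.det) :
    (Q * (P - P * Fᵀ * Mid⁻¹ * F * P) * Qᵀ).PosSemidef := by
  have hPs : Pᵀ = P := by rw [← conjTranspose_eq_transpose_of_trivial]; exact hP.1
  rw [sub_sandwich_eq_congruence P F Mid hPs hF hMid]
  have h1 : Q * ((1 - P * Fᵀ * Mid⁻¹ * F) * P * (1 - P * Fᵀ * Mid⁻¹ * F)ᵀ) * Qᵀ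
      = (Q * (1 - P * Fᵀ * Mid⁻¹ * F)) * P * (Q * (1 - P * Fᵀ * Mid⁻¹ * F))ᴴ := by
    rw [conjTranspose_eq_transpose_of_trivial, transpose_mul]
    simp only [Matrix.mul_assoc]
  rw [h1]
  exact hP.mul_mul_conjTranspose_same _

/-- [folklore] **`flucCov H Q` IS POSITIVE SEMIDEFINITE** for positive definite `H : Matrix ν ν ℝ` with `blockProp H Q` invertible:
§3's congruence at `P := H⁻¹`, `F := Q`, `Mid := blockProp H Q` reads `constrProp H Q = (1 − H⁻¹QᵀG_C Q)·H⁻¹·(1 − H⁻¹QᵀG_C Q)ᵀ`. -/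
theorem posSemidef_flucCov (H : Matrix ν ν ℝ) (Q : Matrix μ ν ℝ) (hH : H.PosDef) (hP : IsUnit (blockProp H Q).det) :
    (flucCov H Q).PosSemidef := by
  have hHu : IsUnit H.det := (Matrix.isUnit_iff_isUnit_det H).mp hH.isUnit
  have hHs : Hᵀ = H := by rw [← conjTranspose_eq_transpose_of_trivial]; exact hH.1
  have hPs : (H⁻¹)ᵀ = H⁻¹ := by rw [transpose_nonsing_inv, hHs]
  rw [flucCov_eq_constrProp H Q hHu hP]
  have h0 : constrProp H Q = H⁻¹ - H⁻¹ * Qᵀ * (blockProp H Q)⁻¹ * Q * H⁻¹ := by simp only [constrProp, minMap]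
  have h1 : (1 - H⁻¹ * Qᵀ * (blockProp H Q)⁻¹ * Q) * H⁻¹ * (1 - H⁻¹ * Qᵀ * (blockProp H Q)⁻¹ * Q)ᵀ
      = (1 - H⁻¹ * Qᵀ * (blockProp H Q)⁻¹ * Q) * H⁻¹ * (1 - H⁻¹ * Qᵀ * (blockProp H Q)⁻¹ * Q)ᴴ := by
    rw [conjTranspose_eq_transpose_of_trivial]
  rw [h0, sub_sandwich_eq_congruence H⁻¹ Q (blockProp H Q) hPs rfl hP, h1]
  exact hH.inv.posSemidef.mul_mul_conjTranspose_same _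

/-! ## §4 (I4) Push-through and the Loewner sandwich `0 ⪯ M_B ⪯ 1` -/

/-- [folklore] **(I4), PUSH-THROUGH** (any field): for `V`, `W` and `W⁻¹ + SᵀV⁻¹S` invertible,
`Sᵀ·(V + S W Sᵀ)⁻¹·S = W⁻¹ − W⁻¹·(W⁻¹ + SᵀV⁻¹S)⁻¹·W⁻¹` (Woodbury `Matrix.add_mul_mul_inv_eq_sub` pushed through `Sᵀ … S`). -/
theorem pushThrough (S : Matrix μ κ 𝕜) (V : Matrix μ μ 𝕜) (W : Matrix κ κ 𝕜) (hV : IsUnit V.det) (hW : IsUnit W.det)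
    (hX : IsUnit (W⁻¹ + Sᵀ * V⁻¹ * S).det) :
    Sᵀ * (V + S * W * Sᵀ)⁻¹ * S = W⁻¹ - W⁻¹ * (W⁻¹ + Sᵀ * V⁻¹ * S)⁻¹ * W⁻¹ := by
  rw [Matrix.add_mul_mul_inv_eq_sub V S W Sᵀ ((Matrix.isUnit_iff_isUnit_det V).mpr hV)
    ((Matrix.isUnit_iff_isUnit_det W).mpr hW) ((Matrix.isUnit_iff_isUnit_det _).mpr hX)]
  have hXX : (W⁻¹ + Sᵀ * V⁻¹ * S) * (W⁻¹ + Sᵀ * V⁻¹ * S)⁻¹ = 1 := Matrix.mul_nonsing_inv _ hX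
  have hXX' : (W⁻¹ + Sᵀ * V⁻¹ * S)⁻¹ * (W⁻¹ + Sᵀ * V⁻¹ * S) = 1 := Matrix.nonsing_inv_mul _ hX
  set X := W⁻¹ + Sᵀ * V⁻¹ * S with hXdef
  have hT : Sᵀ * V⁻¹ * S = X - W⁻¹ := by rw [hXdef]; abel
  have e1 : Sᵀ * (V⁻¹ - V⁻¹ * S * X⁻¹ * Sᵀ * V⁻¹) * S = Sᵀ * V⁻¹ * S - Sᵀ * V⁻¹ * S * X⁻¹ * (Sᵀ * V⁻¹ * S) := by
    simp only [Matrix.mul_sub, Matrix.sub_mul, Matrix.mul_assoc]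
  have e2 : (X - W⁻¹) * X⁻¹ * (X - W⁻¹) = X - W⁻¹ - W⁻¹ + W⁻¹ * X⁻¹ * W⁻¹ := by
    rw [Matrix.sub_mul X W⁻¹ X⁻¹, hXX, Matrix.sub_mul, Matrix.one_mul, Matrix.mul_sub, Matrix.mul_assoc W⁻¹ X⁻¹ X, hXX',
      Matrix.mul_one]
    abel
  rw [e1, hT, e2]
  abel

/-- [folklore] **(I4), `W = 1`**: `Sᵀ·(V + SSᵀ)⁻¹·S = 1 − (1 + SᵀV⁻¹S)⁻¹` — with `G_C⁻¹ = QPQᵀ = SSᵀ + V` (§3 at `Mid = 1`) this is the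
memo's `M_B = Sᵀ(SSᵀ + V_N)⁻¹S = 1 − (1 + SᵀV_N⁻¹S)⁻¹` for invertible `V_N`. -/
theorem pushThrough_one (S : Matrix μ κ 𝕜) (V : Matrix μ μ 𝕜) (hV : IsUnit V.det) (hX : IsUnit (1 + Sᵀ * V⁻¹ * S).det) :
    Sᵀ * (V + S * Sᵀ)⁻¹ * S = 1 - (1 + Sᵀ * V⁻¹ * S)⁻¹ := by
  have h := pushThrough S V 1 hV (by rw [det_one]; exact isUnit_one) (by rw [inv_one]; exact hX)
  rw [inv_one, Matrix.mul_one, Matrix.one_mul, Matrix.mul_one] at h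
  exact h

omit [DecidableEq κ] in
/-- [folklore] **(I4), THE LOEWNER SANDWICH IN RAW LETTERS, NO INVERSE OF `V`** (the memo's «generalised-inverse reading»): for positive
definite `H : Matrix ν ν ℝ` with `blockProp H Q` invertible and `F H⁻¹ Fᵀ = Mid`,
`0 ⪯ S₀ᵀ·G_C·S₀ ⪯ Mid` (`S₀ = QH⁻¹Fᵀ`, `G_C = (blockProp H Q)⁻¹`), i.e. `0 ⪯ M_B ⪯ 1`; the upper half is `F·Γ₀·Fᵀ ⪰ 0` (§2 + `posSemidef_flucCov`). -/
theorem loewner_sandwich (H : Matrix ν ν ℝ) (Q : Matrix μ ν ℝ) (F : Matrix κ ν ℝ) (Mid : Matrix κ κ ℝ) (hH : H.PosDef)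
    (hP : IsUnit (blockProp H Q).det) (hF : F * H⁻¹ * Fᵀ = Mid) :
    ((Q * H⁻¹ * Fᵀ)ᵀ * (blockProp H Q)⁻¹ * (Q * H⁻¹ * Fᵀ)).PosSemidef
      ∧ (Mid - (Q * H⁻¹ * Fᵀ)ᵀ * (blockProp H Q)⁻¹ * (Q * H⁻¹ * Fᵀ)).PosSemidef := by
  have hHu : IsUnit H.det := (Matrix.isUnit_iff_isUnit_det H).mp hH.isUnit
  have hHs : Hᵀ = H := by rw [← conjTranspose_eq_transpose_of_trivial]; exact hH.1
  have hQt : (Qᵀ)ᴴ = Q := by rw [conjTranspose_eq_transpose_of_trivial, transpose_transpose]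
  have hbp : (blockProp H Q).PosSemidef := by
    have h := hH.inv.posSemidef.conjTranspose_mul_mul_same Qᵀ
    rwa [hQt] at h
  refine ⟨?_, ?_⟩
  · have h := hbp.inv.conjTranspose_mul_mul_same (Q * H⁻¹ * Fᵀ)
    rwa [conjTranspose_eq_transpose_of_trivial] at h
  · rw [← weight_sub_deficitCov_eq H Q F Mid hHu hP hHs hF, sub_sub_cancel]
    have h := (posSemidef_flucCov H Q hH hP).mul_mul_conjTranspose_same F
    rwa [conjTranspose_eq_transpose_of_trivial] at h

/-! ## §5 Cauchy–Schwarz for a positive semidefinite form and the per-direction bound -/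

omit [DecidableEq ν] in
/-- [folklore] **CAUCHY–SCHWARZ, DIVISION-FREE**: for positive semidefinite `A : Matrix ν ν ℝ` and `u w : ν → ℝ`,
`(w ⬝ Au)² ≤ (w ⬝ Aw)·(u ⬝ Au)` (discriminant of `t ↦ (w − t•u) ⬝ A (w − t•u) ≥ 0`). -/
theorem dotProduct_mulVec_sq_le (A : Matrix ν ν ℝ) (hA : A.PosSemidef) (u w : ν → ℝ) :
    (w ⬝ᵥ A *ᵥ u) ^ 2 ≤ (w ⬝ᵥ A *ᵥ w) * (u ⬝ᵥ A *ᵥ u) := by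
  have hAs : Aᵀ = A := by rw [← conjTranspose_eq_transpose_of_trivial]; exact hA.1
  have hsymm : u ⬝ᵥ A *ᵥ w = w ⬝ᵥ A *ᵥ u := by rw [dotProduct_mulVec, ← mulVec_transpose, hAs, dotProduct_comm]
  have hq : ∀ t : ℝ, 0 ≤ (u ⬝ᵥ A *ᵥ u) * (t * t) + (-(2 * (w ⬝ᵥ A *ᵥ u))) * t + w ⬝ᵥ A *ᵥ w := by
    intro t
    have h : 0 ≤ (w - t • u) ⬝ᵥ A *ᵥ (w - t • u) := by simpa using hA.dotProduct_mulVec_nonneg (w - t • u)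
    have e : (w - t • u) ⬝ᵥ A *ᵥ (w - t • u)
        = (u ⬝ᵥ A *ᵥ u) * (t * t) + (-(2 * (w ⬝ᵥ A *ᵥ u))) * t + w ⬝ᵥ A *ᵥ w := by
      simp only [mulVec_sub, mulVec_smul, sub_dotProduct, dotProduct_sub, smul_dotProduct, dotProduct_smul, smul_eq_mul, hsymm]
      ring
    rwa [e] at h
  have hd := discrim_le_zero hq
  rw [discrim] at hd
  nlinarith [hd]

/-- [folklore] **CAUCHY–SCHWARZ FOR THE INVERSE**: for positive definite `A : Matrix ν ν ℝ`, `(u ⬝ u)² ≤ (u ⬝ A⁻¹u)·(u ⬝ Au)`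
(§5's inequality at `w := A⁻¹u`). -/
theorem dotProduct_self_sq_le (A : Matrix ν ν ℝ) (hA : A.PosDef) (u : ν → ℝ) :
    (u ⬝ᵥ u) ^ 2 ≤ (u ⬝ᵥ A⁻¹ *ᵥ u) * (u ⬝ᵥ A *ᵥ u) := by
  have hAu : IsUnit A.det := (Matrix.isUnit_iff_isUnit_det A).mp hA.isUnit
  have hAs : Aᵀ = A := by rw [← conjTranspose_eq_transpose_of_trivial]; exact hA.1
  have hAis : (A⁻¹)ᵀ = A⁻¹ := by rw [transpose_nonsing_inv, hAs]
  have h := dotProduct_mulVec_sq_le A hA.posSemidef u (A⁻¹ *ᵥ u)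
  have e1 : (A⁻¹ *ᵥ u) ⬝ᵥ A *ᵥ u = u ⬝ᵥ u := by
    rw [dotProduct_mulVec, vecMul_mulVec, hAis, Matrix.nonsing_inv_mul A hAu, vecMul_one]
  have e2 : (A⁻¹ *ᵥ u) ⬝ᵥ A *ᵥ (A⁻¹ *ᵥ u) = u ⬝ᵥ A⁻¹ *ᵥ u := by
    rw [dotProduct_mulVec, vecMul_mulVec, hAis, Matrix.nonsing_inv_mul A hAu, vecMul_one]
  rwa [e1, e2] at h

omit [DecidableEq κ] in
/-- [folklore] **(I4), THE PER-DIRECTION BOUND** (general rank): for positive definite `A : Matrix μ μ ℝ` (in the reading `A := G_C⁻¹ = QPQᵀ =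
S₀Mid⁻¹S₀ᵀ + V`), `S : Matrix μ κ ℝ`, `φ : κ → ℝ`:  `((Sφ) ⬝ (Sφ))² ≤ (φ ⬝ (SᵀA⁻¹S)φ)·((Sφ) ⬝ A(Sφ))` (`⟨φ, Mφ⟩ ≥ |Sφ|⁴∕⟨Sφ, ASφ⟩`). -/
theorem direction_bound (A : Matrix μ μ ℝ) (hA : A.PosDef) (S : Matrix μ κ ℝ) (φ : κ → ℝ) :
    ((S *ᵥ φ) ⬝ᵥ (S *ᵥ φ)) ^ 2 ≤ (φ ⬝ᵥ (Sᵀ * A⁻¹ * S) *ᵥ φ) * ((S *ᵥ φ) ⬝ᵥ A *ᵥ (S *ᵥ φ)) := by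
  have e : φ ⬝ᵥ (Sᵀ * A⁻¹ * S) *ᵥ φ = (S *ᵥ φ) ⬝ᵥ A⁻¹ *ᵥ (S *ᵥ φ) := by
    rw [← mulVec_mulVec, ← mulVec_mulVec, dotProduct_mulVec φ Sᵀ, vecMul_transpose]
  rw [e]
  exact dotProduct_self_sq_le A hA (S *ᵥ φ)

/-! ## §6 (I5) The weighted constrained Woodbury, `R^g = J·K_C·Jᵀ`, and the residual-mode determinant without square roots -/

/-- [folklore] **WOODBURY, WEIGHTED DOWNDATE (right inverse)**: for invertible `K`, `W` and `W⁻¹ − UK⁻¹Uᵀ`,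
`(K − UᵀWU)·(K⁻¹ + K⁻¹Uᵀ(W⁻¹ − UK⁻¹Uᵀ)⁻¹UK⁻¹) = 1` (g8's `woodbury_downdate_mul` is `W = 1`). -/
theorem woodbury_weighted_downdate_mul (K : Matrix ι ι 𝕜) (U : Matrix κ ι 𝕜) (W : Matrix κ κ 𝕜) (hK : IsUnit K.det)
    (hW : IsUnit W.det) (hM : IsUnit (W⁻¹ - U * K⁻¹ * Uᵀ).det) :
    (K - Uᵀ * W * U) * (K⁻¹ + K⁻¹ * Uᵀ * (W⁻¹ - U * K⁻¹ * Uᵀ)⁻¹ * U * K⁻¹) = 1 := by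
  set Ki := K⁻¹ with hKi
  set S : Matrix κ κ 𝕜 := U * Ki * Uᵀ with hS
  set M : Matrix κ κ 𝕜 := (W⁻¹ - S)⁻¹ with hMdef
  have hKKi : K * Ki = 1 := Matrix.mul_nonsing_inv K hK
  have hSM : (W⁻¹ - S) * M = 1 := Matrix.mul_nonsing_inv _ hM
  have hWW : W * W⁻¹ = 1 := Matrix.mul_nonsing_inv W hW
  have key : M - W * (S * M) = W := by
    have h1 : W * ((W⁻¹ - S) * M) = W := by rw [hSM, Matrix.mul_one]
    rw [Matrix.sub_mul, Matrix.mul_sub, ← Matrix.mul_assoc W W⁻¹ M, hWW, Matrix.one_mul] at h1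
    exact h1
  have e1 : (K - Uᵀ * W * U) * Ki = 1 - Uᵀ * (W * (U * Ki)) := by
    rw [Matrix.sub_mul, hKKi]; simp only [Matrix.mul_assoc]
  have e2 : (K - Uᵀ * W * U) * (Ki * Uᵀ * M * U * Ki) = Uᵀ * (M * (U * Ki)) - Uᵀ * (W * (S * (M * (U * Ki)))) := by
    rw [Matrix.sub_mul]
    congr 1
    · calc K * (Ki * Uᵀ * M * U * Ki) = (K * Ki) * (Uᵀ * (M * (U * Ki))) := by simp only [Matrix.mul_assoc]
        _ = Uᵀ * (M * (U * Ki)) := by rw [hKKi, Matrix.one_mul]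
    · simp only [hS, Matrix.mul_assoc]
  rw [Matrix.mul_add, e1, e2]
  have e3 : Uᵀ * (M * (U * Ki)) - Uᵀ * (W * (S * (M * (U * Ki)))) = Uᵀ * (W * (U * Ki)) := by
    rw [← Matrix.mul_sub, ← Matrix.mul_assoc S M (U * Ki), ← Matrix.mul_assoc W (S * M) (U * Ki), ← Matrix.sub_mul, key]
  rw [e3, sub_add_cancel]

/-- [folklore] Hence `K − UᵀWU` is invertible with `(K − UᵀWU)⁻¹ = K⁻¹ + K⁻¹Uᵀ(W⁻¹ − UK⁻¹Uᵀ)⁻¹UK⁻¹`. -/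
theorem inv_weighted_downdate (K : Matrix ι ι 𝕜) (U : Matrix κ ι 𝕜) (W : Matrix κ κ 𝕜) (hK : IsUnit K.det) (hW : IsUnit W.det)
    (hM : IsUnit (W⁻¹ - U * K⁻¹ * Uᵀ).det) :
    IsUnit (K - Uᵀ * W * U).det ∧ (K - Uᵀ * W * U)⁻¹ = K⁻¹ + K⁻¹ * Uᵀ * (W⁻¹ - U * K⁻¹ * Uᵀ)⁻¹ * U * K⁻¹ :=
  ⟨Matrix.isUnit_det_of_right_inverse (woodbury_weighted_downdate_mul K U W hK hW hM),
    Matrix.inv_eq_right_inv (woodbury_weighted_downdate_mul K U W hK hW hM)⟩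

/-- [folklore] **DETERMINANT OF THE WEIGHTED DOWNDATE**: `det (K − UᵀWU) = det K · det (1 − W·(UK⁻¹Uᵀ))` (`K` invertible). -/
theorem det_weighted_downdate (K : Matrix ι ι 𝕜) (U : Matrix κ ι 𝕜) (W : Matrix κ κ 𝕜) (hK : IsUnit K.det) :
    (K - Uᵀ * W * U).det = K.det * (1 - W * (U * K⁻¹ * Uᵀ)).det := by
  have hfac : K - Uᵀ * W * U = K * (1 - K⁻¹ * Uᵀ * (W * U)) := by
    rw [Matrix.mul_sub, Matrix.mul_one, ← Matrix.mul_assoc K, ← Matrix.mul_assoc K, Matrix.mul_nonsing_inv K hK,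
      Matrix.one_mul, Matrix.mul_assoc]
  rw [hfac, det_mul, det_one_sub_mul_comm]
  simp only [Matrix.mul_assoc]

omit [Fintype ν] [Fintype μ] [DecidableEq κ] [DecidableEq ν] [DecidableEq μ] in
/-- [folklore] The bordered matrix of the weighted downdate is the weighted downdate of the bordered matrix by the lift `Û := fromCols F 0`:
`kkt (H − FᵀWF) Q = kkt H Q − ÛᵀWÛ`. -/
theorem kkt_weighted_downdate_eq (H : Matrix ν ν 𝕜) (Q : Matrix μ ν 𝕜) (F : Matrix κ ν 𝕜) (W : Matrix κ κ 𝕜) :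
    kkt (H - Fᵀ * W * F) Q = kkt H Q - (fromCols F (0 : Matrix κ μ 𝕜))ᵀ * W * fromCols F (0 : Matrix κ μ 𝕜) := by
  rw [transpose_fromCols, fromRows_mul, fromRows_mul_fromCols, kkt_eq_fromBlocks, kkt_eq_fromBlocks]
  ext (i | i) (j | j) <;> simp [fromBlocks]

/-- [folklore] **INVERTIBILITY OF THE WEIGHTED-DOWNDATED BORDERED MATRIX**: `IsUnit (kkt H Q).det`, `IsUnit W.det` and
`IsUnit (W⁻¹ − F·flucCov H Q·Fᵀ).det ⟹ IsUnit (kkt (H − FᵀWF) Q).det` — no invertibility of `H`. -/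
theorem isUnit_det_kkt_weighted_downdate (H : Matrix ν ν 𝕜) (Q : Matrix μ ν 𝕜) (F : Matrix κ ν 𝕜) (W : Matrix κ κ 𝕜)
    (h : IsUnit (kkt H Q).det) (hW : IsUnit W.det) (hM : IsUnit (W⁻¹ - F * flucCov H Q * Fᵀ).det) :
    IsUnit (kkt (H - Fᵀ * W * F) Q).det := by
  rw [kkt_weighted_downdate_eq]
  refine (inv_weighted_downdate _ _ _ h hW ?_).1
  rw [lift_mul_kktInv_mul_lift_transpose]; exact hM

/-- [folklore] The full bordered inverse after the weighted downdate. -/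
theorem kktInv_weighted_downdate (H : Matrix ν ν 𝕜) (Q : Matrix μ ν 𝕜) (F : Matrix κ ν 𝕜) (W : Matrix κ κ 𝕜)
    (h : IsUnit (kkt H Q).det) (hW : IsUnit W.det) (hM : IsUnit (W⁻¹ - F * flucCov H Q * Fᵀ).det) :
    (kkt (H - Fᵀ * W * F) Q)⁻¹ = (kkt H Q)⁻¹
      + fromRows (flucCov H Q * Fᵀ) (minOpL H Q * Fᵀ) * (W⁻¹ - F * flucCov H Q * Fᵀ)⁻¹
          * fromCols (F * flucCov H Q) (F * minOp H Q) := by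
  have hM' : IsUnit (W⁻¹ - fromCols F (0 : Matrix κ μ 𝕜) * (kkt H Q)⁻¹ * (fromCols F (0 : Matrix κ μ 𝕜))ᵀ).det := by
    rw [lift_mul_kktInv_mul_lift_transpose]; exact hM
  rw [kkt_weighted_downdate_eq, (inv_weighted_downdate _ _ _ h hW hM').2, lift_mul_kktInv_mul_lift_transpose,
    Matrix.mul_assoc (kkt H Q)⁻¹, ← (lift_mul_kktInv H Q F).2, Matrix.mul_assoc _ (fromCols F 0), (lift_mul_kktInv H Q F).1]
  simp only [Matrix.mul_assoc]

/-- [folklore] **(I5), THE WEIGHTED CONSTRAINED WOODBURY FORMULA**: with `Γ₀ := flucCov H Q`,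
`flucCov (H − FᵀWF) Q = Γ₀ + Γ₀·Fᵀ·(W⁻¹ − F·Γ₀·Fᵀ)⁻¹·F·Γ₀` under `IsUnit (kkt H Q).det`, `IsUnit W.det`, `IsUnit (W⁻¹ − FΓ₀Fᵀ).det` ONLY. -/
theorem flucCov_weighted_downdate (H : Matrix ν ν 𝕜) (Q : Matrix μ ν 𝕜) (F : Matrix κ ν 𝕜) (W : Matrix κ κ 𝕜)
    (h : IsUnit (kkt H Q).det) (hW : IsUnit W.det) (hM : IsUnit (W⁻¹ - F * flucCov H Q * Fᵀ).det) :
    flucCov (H - Fᵀ * W * F) Q = flucCov H Q + flucCov H Q * Fᵀ * (W⁻¹ - F * flucCov H Q * Fᵀ)⁻¹ * F * flucCov H Q := by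
  have hX := kktInv_weighted_downdate H Q F W h hW hM
  rw [fromRows_mul, fromRows_mul_fromCols] at hX
  have h11 := congrArg Matrix.toBlocks₁₁ hX
  have hadd : ∀ (A B : Matrix (ν ⊕ μ) (ν ⊕ μ) 𝕜), (A + B).toBlocks₁₁ = A.toBlocks₁₁ + B.toBlocks₁₁ := fun A B => rfl
  rw [hadd, toBlocks_fromBlocks₁₁] at h11
  show ((kkt (H - Fᵀ * W * F) Q)⁻¹).toBlocks₁₁ = ((kkt H Q)⁻¹).toBlocks₁₁ + _
  rw [h11]
  simp only [flucCov, Matrix.mul_assoc]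

/-- [folklore] **(I5) IN THE MEMO's LETTERS** (`W := Mid⁻¹`): with `Γ₀ := flucCov H Q` and `K_C := (Mid − FΓ₀Fᵀ)⁻¹`,
`flucCov (H − FᵀMid⁻¹F) Q = Γ₀ + Γ₀·Fᵀ·K_C·F·Γ₀` under `IsUnit (kkt H Q).det`, `IsUnit Mid.det`, `IsUnit (Mid − FΓ₀Fᵀ).det`. -/
theorem flucCov_sub_deficit (H : Matrix ν ν 𝕜) (Q : Matrix μ ν 𝕜) (F : Matrix κ ν 𝕜) (Mid : Matrix κ κ 𝕜)
    (h : IsUnit (kkt H Q).det) (hMid : IsUnit Mid.det) (hK : IsUnit (Mid - F * flucCov H Q * Fᵀ).det) :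
    flucCov (H - Fᵀ * Mid⁻¹ * F) Q = flucCov H Q + flucCov H Q * Fᵀ * (Mid - F * flucCov H Q * Fᵀ)⁻¹ * F * flucCov H Q := by
  have hW : IsUnit (Mid⁻¹).det := (Matrix.isUnit_nonsing_inv_det_iff (A := Mid)).mpr hMid
  have e : Mid⁻¹⁻¹ = Mid := Matrix.nonsing_inv_nonsing_inv Mid hMid
  have hM : IsUnit (Mid⁻¹⁻¹ - F * flucCov H Q * Fᵀ).det := by rw [e]; exact hK
  rw [flucCov_weighted_downdate H Q F Mid⁻¹ h hW hM, e]

/-- [folklore] **(I5), THE RESIDUAL COVARIANCE IS SQUARE-ROOT-FREE**: for symmetric `H`, with `J := flucCov H Q·Fᵀ` and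
`K_C := (Mid − F·flucCov H Q·Fᵀ)⁻¹`,  `R^g := flucCov (H − FᵀMid⁻¹F) Q − flucCov H Q = J·K_C·Jᵀ`. -/
theorem resCov_eq_sandwich (H : Matrix ν ν 𝕜) (Q : Matrix μ ν 𝕜) (F : Matrix κ ν 𝕜) (Mid : Matrix κ κ 𝕜) (hHs : Hᵀ = H)
    (h : IsUnit (kkt H Q).det) (hMid : IsUnit Mid.det) (hK : IsUnit (Mid - F * flucCov H Q * Fᵀ).det) :
    flucCov (H - Fᵀ * Mid⁻¹ * F) Q - flucCov H Q
      = (flucCov H Q * Fᵀ) * (Mid - F * flucCov H Q * Fᵀ)⁻¹ * (flucCov H Q * Fᵀ)ᵀ := by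
  rw [flucCov_sub_deficit H Q F Mid h hMid hK, add_sub_cancel_left, transpose_mul, transpose_transpose,
    flucCov_transpose_of_symm H Q hHs]
  simp only [Matrix.mul_assoc]

/-- [folklore] **THE BORDERED DETERMINANT OF THE WEIGHTED DOWNDATE**: `det kkt (H − FᵀWF) Q = det kkt H Q · det (1 − W·(F·flucCov H Q·Fᵀ))`
under `IsUnit (kkt H Q).det` only. -/
theorem det_kkt_weighted_downdate (H : Matrix ν ν 𝕜) (Q : Matrix μ ν 𝕜) (F : Matrix κ ν 𝕜) (W : Matrix κ κ 𝕜)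
    (h : IsUnit (kkt H Q).det) : (kkt (H - Fᵀ * W * F) Q).det = (kkt H Q).det * (1 - W * (F * flucCov H Q * Fᵀ)).det := by
  rw [kkt_weighted_downdate_eq, det_weighted_downdate _ _ _ h, lift_mul_kktInv_mul_lift_transpose]

/-- [folklore] **(I5), THE RESIDUAL-MODE DETERMINANT WITHOUT SQUARE ROOTS**: for invertible `Mid`,
`det Mid · det kkt (H − FᵀMid⁻¹F) Q = det kkt H Q · det (Mid − F·flucCov H Q·Fᵀ)` (cf. `ReGaugedShotDeterminant.det_kkt_downdate`: `det M_B`). -/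
theorem det_kkt_sub_deficit (H : Matrix ν ν 𝕜) (Q : Matrix μ ν 𝕜) (F : Matrix κ ν 𝕜) (Mid : Matrix κ κ 𝕜) (h : IsUnit (kkt H Q).det)
    (hMid : IsUnit Mid.det) :
    Mid.det * (kkt (H - Fᵀ * Mid⁻¹ * F) Q).det = (kkt H Q).det * (Mid - F * flucCov H Q * Fᵀ).det := by
  rw [det_kkt_weighted_downdate H Q F Mid⁻¹ h, mul_left_comm, ← det_mul, Matrix.mul_sub, Matrix.mul_one, ← Matrix.mul_assoc,
    Matrix.mul_nonsing_inv Mid hMid, Matrix.one_mul]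

/-- [folklore] **(I2) + (I5)**: under the hypotheses of both, the residual-mode factor is the determinant of the coarse sandwich,
`det Mid · det kkt (H − FᵀMid⁻¹F) Q = det kkt H Q · det (S₀ᵀ·G_C·S₀)`. -/
theorem det_kkt_sub_deficit_eq_sandwich (H : Matrix ν ν 𝕜) (Q : Matrix μ ν 𝕜) (F : Matrix κ ν 𝕜) (Mid : Matrix κ κ 𝕜)
    (hH : IsUnit H.det) (hP : IsUnit (blockProp H Q).det) (hHs : Hᵀ = H) (hF : F * H⁻¹ * Fᵀ = Mid) (h : IsUnit (kkt H Q).det)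
    (hMid : IsUnit Mid.det) :
    Mid.det * (kkt (H - Fᵀ * Mid⁻¹ * F) Q).det = (kkt H Q).det * ((Q * H⁻¹ * Fᵀ)ᵀ * (blockProp H Q)⁻¹ * (Q * H⁻¹ * Fᵀ)).det := by
  rw [det_kkt_sub_deficit H Q F Mid h hMid, weight_sub_deficitCov_eq H Q F Mid hH hP hHs hF]

end Summit.QuantumFields.BalabanUV.Beta.FP.ResidualModeIdentities
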